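import Mathlib
import HarnessLib
import Summits.AtomisticToContinuum.Crystallization.Theses.PricedLinkCensus

/-!
# Sketch — crux `PricedLinkCensus.LocalToGlobal` (item stmt-AtomisticToContinuum-14232), ideator 3

First lemmas of the two idea cards `periodise-dilate-shape-transfer` and `stress-free-affine-gauge`.
Nothing here is filed as an item; the crux is fixed.
-/

noncomputable section

namespace Summit.AtomisticToContinuum.Crystallization.Cruxes.LocalToGlobal.Sketch

open Literature.MathematicalPhysics.StatisticalMechanics Literature.Geometry.DiscreteGeometry
open Summit.AtomisticToContinuum.Crystallization.Theses.PricedLinkCensus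

/-- ambient space -/
abbrev E3 := EuclideanSpace ℝ (Fin 3)

-- the route's range-2 truncation `V_χ = χ·V_LJ`, `χ(r) = min(1, max(0, 4 − 2r))` (syntactic)
local notation "Vχ" => (fun r : ℝ => min 1 (max 0 (4 - 2 * r)) * lennardJones r)
-- `e* = ⨅_Q e_LJ(Q)` over all periodic configurations
set_option quotPrecheck false in
local notation "eStar" =>
  (⨅ Q : PeriodicConfiguration 3, PeriodicConfiguration.energyPerParticle Q lennardJones)
-- `e_χ* = ⨅_Q e_χ(Q)`
set_option quotPrecheck false in
local notation "eChiStar" =>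
  (⨅ Q : PeriodicConfiguration 3,
    PeriodicConfiguration.energyPerParticle Q (fun r : ℝ => min 1 (max 0 (4 - 2 * r)) * lennardJones r))

/-! ## Card 1 (`periodise-dilate-shape-transfer`): dilation covariance of the census -/

/-- RELATIVE COERCIVITY AT ONE DILATION (the residual of the dilation lever): there are a weight
`θ > 0`, a dilation `lam > 0` and a boundary constant `C` such that for every finite injective
configuration `y`, the Lennard-Jones excess over `N·e*` dominates `θ` times the truncated excess of
the DILATED configuration `lam • y` over `N·e_χ*`, up to `C·N^{2/3}`.  No charge, no bond graph, no
tolerance appears. -/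
def RelativeCoercivity : Prop :=
  ∃ θ lam C : ℝ, 0 < θ ∧ 0 < lam ∧ ∀ (N : ℕ) (y : Fin N → E3), Function.Injective y →
    θ * (interactionEnergy Vχ (lam • y) - (N : ℝ) * eChiStar) - C * (N : ℝ) ^ (2 / 3 : ℝ)
      ≤ interactionEnergy lennardJones y - (N : ℝ) * eStar

/-- Link charge is dilation invariant (tree: `isChargeFree_smul_iff`), so the number of charged
sites of `lam • y` equals that of `y`. -/
theorem card_charged_smul {N : ℕ} (y : Fin N → E3) {lam : ℝ} (h : lam ≠ 0) :
    Nat.card {i : Fin N // ¬ IsChargeFree (1 / 100 : ℝ) (lam • y) i} =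
      Nat.card {i : Fin N // ¬ IsChargeFree (1 / 100 : ℝ) y i} :=
  Nat.card_congr (Equiv.subtypeEquivRight fun i => by rw [isChargeFree_smul_iff h])

/-- FIRST LEMMA OF CARD 1 (proved): the census applied to the dilated configuration prices the
charge of `y` itself, so relative coercivity at one dilation already gives the crux, with
`κ' = θ·κ`. -/
theorem localToGlobal_of_relativeCoercivity (h : RelativeCoercivity) : LocalToGlobal := by
  intro hT
  obtain ⟨θ, lam, C, hθ, hlam, hRC⟩ := h
  obtain ⟨κ, hκ, hcensus⟩ := hT
  refine ⟨θ * κ, C, mul_pos hθ hκ, fun N y hy => ?_⟩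
  have hinj : Function.Injective (lam • y) := fun i j hij =>
    hy (smul_right_injective E3 hlam.ne' (by simpa using hij))
  have h1 := hcensus N (lam • y) hinj
  have h2 := hRC N y hy
  rw [card_charged_smul y hlam.ne'] at h1
  have h4 : θ * κ * (Nat.card {i : Fin N // ¬ IsChargeFree (1 / 100 : ℝ) y i} : ℝ) ≤
      θ * (interactionEnergy Vχ (lam • y) - (N : ℝ) * eChiStar) := by
    rw [mul_assoc]
    exact mul_le_mul_of_nonneg_left (by linarith) hθ.le
  linarith

/-! ### The periodic transfer (lever (P): periodisation kills the boundary term and makes `E ≥ N e*` free) -/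

/-- charge fraction of a periodic configuration: charged motif points (charge read in the infinite
point set `Q.points`) over the motif size. -/
def chargeFraction (Q : PeriodicConfiguration 3) : ℝ :=
  (Nat.card {x : Q.motif //
      ¬ IsChargeFree (1 / 100 : ℝ) (fun p : Q.points => (p : E3))
        ⟨x.1, Q.mem_points_of_mem_motif x.2⟩} : ℝ) / Q.motif.card

/-- PERIODIC PRICED GAP: every periodic configuration pays `κ` per unit of charge fraction above
`e*` — no boundary term at all. -/
def PeriodicPricedGap : Prop :=
  ∃ κ : ℝ, 0 < κ ∧ ∀ Q : PeriodicConfiguration 3,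
    eStar + κ * chargeFraction Q ≤ Q.energyPerParticle lennardJones

/-- LINEAR CHARGE DECAY NEAR THE MINIMUM: only periodic configurations within `η₀` per particle of
`e*` need pricing (the far regime is free since `chargeFraction ≤ 1`). -/
def LinNearMin : Prop :=
  ∃ η₀ κ : ℝ, 0 < η₀ ∧ 0 < κ ∧ ∀ Q : PeriodicConfiguration 3,
    Q.energyPerParticle lennardJones < eStar + η₀ →
      eStar + κ * chargeFraction Q ≤ Q.energyPerParticle lennardJones

/-- Transfer claims of card 1 (statement shapes; the first is periodisation `y ↦ y + L·ℤ³`,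
`L > 3·diam y + 2`, cross terms of `V_LJ` non-positive; the second is `min(η₀, κ)`). -/
def PeriodisationTransfer : Prop := (PeriodicPricedGap → ChargedEnergyGap) ∧ (LinNearMin → PeriodicPricedGap)

/-! ## Card 2 (`stress-free-affine-gauge`): charge is invariant under near-similar affine maps
away from threshold-critical bonds -/

/-- FIRST LEMMA OF CARD 2 (statement): let `A` be a linear map with
`(1−δ)·lam·‖v‖ ≤ ‖A v‖ ≤ (1+δ)·lam·‖v‖`.  If no pair of sites within `3·nn_i` of `y i` has its
bond ratio `dist / min(nn_j, nn_k)` in the critical window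
`((1+η)(1−δ)/(1+δ), (1+η)(1+δ)/(1−δ)]`, then site `i` is charge-free in `A ∘ y` iff it is in `y`
(all bonds and ring numbers entering `IsChargeFree η · i` live in the `1.04·nn_i`-ball). -/
def AffineGaugeChargeInvariance : Prop :=
  ∀ (η δ lam : ℝ), 0 < η → η ≤ 1 / 100 → 0 ≤ δ → δ < 1 / 100 → 0 < lam →
    ∀ A : E3 →ₗ[ℝ] E3,
      (∀ v : E3, (1 - δ) * lam * ‖v‖ ≤ ‖A v‖ ∧ ‖A v‖ ≤ (1 + δ) * lam * ‖v‖) →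
      ∀ (N : ℕ) (y : Fin N → E3) (i : Fin N),
        (∀ j k : Fin N, j ≠ k →
            dist (y i) (y j) ≤ 3 * nearestDist y i → dist (y i) (y k) ≤ 3 * nearestDist y i →
              dist (y j) (y k) / min (nearestDist y j) (nearestDist y k) ∉
                Set.Ioc ((1 + η) * (1 - δ) / (1 + δ)) ((1 + η) * (1 + δ) / (1 - δ))) →
        (IsChargeFree η (fun j => A (y j)) i ↔ IsChargeFree η y i)

end Summit.AtomisticToContinuum.Crystallization.Cruxes.LocalToGlobal.Sketch
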